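/-
Origin: expansion seat `prover-pub-hodgecm-mc-sinst-1-g8-0`, handover #1233 2026-08-20T18:24Z md5 277686f016ea (346 l.; NEW additive universe-free leaf, ns HodgeCM.BallFormsHecke; imports #R92 Model/BallFormsTransfer only; `heckeStab`, `hecke := Tr ∘ g^*`, double-coset invariance, `toGroupFun_hecke`, transfer transitivity, NORMALISATION IDENTITY vs the vendored `levelProj_map_heckeCorrespondenceAction`, holomorphy on 𝔹²; NAME LIST: HodgeCM.BallFormsHecke.hecke_mem_factorForms · HodgeCM.BallFormsHecke.sum_factorPullback_mul_out_eq_relIndex_smul_hecke' · HodgeCM.BallFormsHecke.hecke_mem_holFactorForms) (`HOME/mc/pub-hodgecm-mc-sinst-1-g8/stage/HodgeCM/Model/BallFormsHecke.lean`, md5 277686f016ea, 346 lines);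
landed by the gen-24 packager (p-g24) in gate run 59 as `HodgeCM/Model/BallFormsHecke.lean` (verbatim).
-/
/-
Copyright (c) 2026 the pub-hodgecm formalisation cell (harness21).  New file, not vendored.
Origin: session prover-pub-hodgecm-mc-sinst-1-g8-0 (unit pub-hodgecm-mc-sinst-1-g8, S-INSTANCE CONSTRUCTOR gen 8; free capacity lent to the
(J-Liu-Θ) junction behind E's row 9 `hΘ`, scope memo `HOME/mc/pub-hodgecm-mc-binder-1-g14/JLIU-THETA-SCOPE.md` §9 (J2): «Hecke operator = sum of
translates on holomorphic one-forms»), 2026-08-20.  Intended final place: `HodgeCM/Model/BallFormsHecke.lean` (NEW additive leaf, universe-free;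
imports ONLY binder-1's #R92 `HodgeCM.Model.BallFormsTransfer` (RUN 57); nothing imports it; drop alone on bounce).
-/
import Summits.HodgeConjecture.HodgeCM.Model.BallFormsTransfer

set_option autoImplicit false

/-!
# The Hecke operator `T_g = T_{Γ g Γ}` on sections of an automorphy factor — (J2) ingredient, section-level half

KERNEL definitions and lemmas over the vendored `BallForms.factorPullback` / `factorForms` vocabulary ([Borel1997 §5.13] as vendored in
`UnitaryBallClassMap`) and binder-1's transfer `BallFormsTransfer.transfer` (#R92); nothing cited anew, nothing minted.
For a pull-back cocycle `A : G → Y → End V`, a subgroup `Γ ≤ G` and `g ∈ G` with `Γ' := Γ ∩ g⁻¹ Γ g` (`heckeStab Γ g`) of finite index in `Γ`: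

* `hecke A Γ g F := Tr_{Γ ← Γ'} (g^* F) = Σ_{γΓ' ∈ Γ/Γ'} (g γ⁻¹)^* F` (`hecke_eq_sum`) — the classical action of the double coset
  `Γ g Γ = ⊔_{γΓ'} Γ g γ⁻¹` on `Γ`-forms ([Shimura 1971, §3.4 (3.4.1)] as vendored in `HeckeCorrespondenceAction`'s docstring; here a DEFINITION
  over real carriers, no record);
* `hecke_mem_factorForms` — `T_g` of a `Γ`-form is a `Γ`-form; `hecke_of_mem` — `T_γ F = F` for `γ ∈ Γ`; `hecke_add/_smul`;
  `hecke_mul_left_of_mem` / `hecke_mul_right_of_mem` — `T_{γ g} = T_g = T_{g γ}` on `Γ`-forms (`γ ∈ Γ`): `T_g` depends only on `Γ g Γ`;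
* `toGroupFun_hecke` — on the group, `u_{T_g F}(x) = Σ_{γΓ'} u_F(g γ⁻¹ x)`;
* `transfer_eq_relIndex_smul_transfer` — transitivity of the transfer through an intermediate level `N ≤ Γ' ≤ Γ` on `Γ'`-forms:
  `Tr_{Γ←N} F = [Γ' : N] • Tr_{Γ←Γ'} F`;
* `sum_factorPullback_mul_out_eq_relIndex_smul_hecke` — THE NORMALISATION IDENTITY matching the vendored topological operator
  (`levelProj_map_heckeCorrespondenceAction`: `π^*(T_g x) = [Γ' : N_g]⁻¹ Σ_{γN_g ∈ Γ/N_g} (π_g ∘ γN_g)^* x`, `π_g ∘ γN_g = [v] ↦ [g γ v]`):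
  for `N ≤ Γ'` with `N ∩ Γ` normal in `Γ`, `Σ_{γN ∈ Γ/N} (g γ)^* F = [Γ' : N] • T_g F` on `Γ`-forms;
* on `𝔹²` with the cotangent cocycle: `hecke_mem_holFactorForms` — `T_g` of a holomorphic `Γ`-form is a holomorphic `Γ`-form.
This is the section-level half of (J2) («`classLift (T_g ω) = [Γ':N_g]⁻¹ Σ_q translate (g γ̃_q) (classLift ω)`», memo §9); the cohomological half
(de Rham naturality for the level covers) is the HECKE-TOWER node's.  0 proof holes, 0 `axiom`; `#print axioms` ⊆ {propext, Classical.choice, Quot.sound}.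
-/

noncomputable section

open Literature.AlgebraicGeometry.ShimuraVarieties
open Literature.AlgebraicGeometry.ShimuraVarieties.BallForms (factorPullback factorPullback_apply factorPullback_mul
  factorPullback_one mem_factorForms_iff_factorPullback_eq factorPullback_mem_factorForms)
open Literature.NumberTheory.Automorphic.AutomorphyFactor
open HodgeCM.BallFormsTransfer

namespace HodgeCM

namespace BallFormsHecke

variable {G Y R V : Type*} [Group G] [MulAction G Y] [CommRing R] [AddCommGroup V] [Module R V]
variable {A : G → Y → Module.End R V}

/-! ### The Hecke stabiliser `Γ ∩ g⁻¹ Γ g` -/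

/-- **The Hecke stabiliser** `Γ' = Γ ∩ g⁻¹ Γ g = {δ ∈ Γ | g δ g⁻¹ ∈ Γ}` of `g` (the group `Γ_{(g)}` with `Γ g Γ = ⊔_{Γ' γ} Γ g γ`).
[cite: Shimura1973, §3.1 Prop. 3.1] -/
def heckeStab (Γ : Subgroup G) (g : G) : Subgroup G := Γ ⊓ Γ.comap (MulAut.conj g).toMonoidHom

/-- Membership in the Hecke stabiliser. [folklore] -/
theorem mem_heckeStab_iff {Γ : Subgroup G} {g δ : G} : δ ∈ heckeStab Γ g ↔ δ ∈ Γ ∧ g * δ * g⁻¹ ∈ Γ :=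
  Iff.rfl

/-- `Γ ∩ g⁻¹ Γ g ≤ Γ`. [folklore] -/
theorem heckeStab_le (Γ : Subgroup G) (g : G) : heckeStab Γ g ≤ Γ := inf_le_left

/-- For `g ∈ Γ` the Hecke stabiliser is `Γ` itself. [folklore] -/
theorem heckeStab_of_mem {Γ : Subgroup G} {g : G} (hg : g ∈ Γ) : heckeStab Γ g = Γ := by
  ext δ
  simp only [mem_heckeStab_iff, and_iff_left_iff_imp]
  exact fun hδ => Γ.mul_mem (Γ.mul_mem hg hδ) (Γ.inv_mem hg)

/-- Left `Γ`-invariance: `Γ ∩ (γ g)⁻¹ Γ (γ g) = Γ ∩ g⁻¹ Γ g` for `γ ∈ Γ`. [folklore] -/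
theorem heckeStab_mul_left_of_mem {Γ : Subgroup G} {γ : G} (hγ : γ ∈ Γ) (g : G) :
    heckeStab Γ (γ * g) = heckeStab Γ g := by
  ext δ
  simp only [mem_heckeStab_iff, and_congr_right_iff]
  intro _
  rw [show γ * g * δ * (γ * g)⁻¹ = γ * (g * δ * g⁻¹) * γ⁻¹ by group]
  exact ⟨fun h => by
      have h' := Γ.mul_mem (Γ.mul_mem (Γ.inv_mem hγ) h) hγ
      rwa [show γ⁻¹ * (γ * (g * δ * g⁻¹) * γ⁻¹) * γ = g * δ * g⁻¹ by group] at h',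
    fun h => Γ.mul_mem (Γ.mul_mem hγ h) (Γ.inv_mem hγ)⟩

/-- Right `Γ`-conjugation: `δ ∈ Γ ∩ (g γ)⁻¹ Γ (g γ) ↔ γ δ γ⁻¹ ∈ Γ ∩ g⁻¹ Γ g` for `γ ∈ Γ`. [folklore] -/
theorem mem_heckeStab_mul_right_iff {Γ : Subgroup G} {γ : G} (hγ : γ ∈ Γ) (g δ : G) :
    δ ∈ heckeStab Γ (g * γ) ↔ γ * δ * γ⁻¹ ∈ heckeStab Γ g := by
  simp only [mem_heckeStab_iff]
  rw [show g * γ * δ * (g * γ)⁻¹ = g * (γ * δ * γ⁻¹) * g⁻¹ by group]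
  exact and_congr_left fun _ =>
    ⟨fun h => Γ.mul_mem (Γ.mul_mem hγ h) (Γ.inv_mem hγ),
      fun h => by
        have h' := Γ.mul_mem (Γ.mul_mem (Γ.inv_mem hγ) h) hγ
        rwa [show γ⁻¹ * (γ * δ * γ⁻¹) * γ = δ by group] at h'⟩

/-- A `Γ'`-form is an `N`-form for every `N ≤ Γ'`. [folklore] -/
theorem mem_factorForms_of_le {N Γ' : Subgroup G} (h : N ≤ Γ') {F : Y → V} (hF : F ∈ factorForms Γ' A) :
    F ∈ factorForms N A :=
  mem_factorForms_iff_factorPullback_eq.mpr fun γ hγ => (mem_factorForms_iff_factorPullback_eq.mp hF) γ (h hγ)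

/-- **`g^*` carries `Γ`-forms to `Γ ∩ g⁻¹ Γ g`-forms** (indeed to `g⁻¹ Γ g`-forms). [cite: Borel1997, §5.13] -/
theorem factorPullback_mem_factorForms_heckeStab (hA : IsPullbackCocycle A) {Γ : Subgroup G} {F : Y → V}
    (hF : F ∈ factorForms Γ A) (g : G) : factorPullback A g F ∈ factorForms (heckeStab Γ g) A :=
  factorPullback_mem_factorForms hA hF fun _ hδ => (mem_heckeStab_iff.mp hδ).2

/-! ### The Hecke operator on sections -/

variable (A) in
/-- **The Hecke operator `T_g = T_{Γ g Γ}` on sections** of the factor `A`, for `g` with `Γ' = Γ ∩ g⁻¹ Γ g` of finite index in `Γ`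
(`Fintype (Γ ⧸ Γ'.subgroupOf Γ)`, e.g. `Subgroup.fintypeQuotientOfFiniteIndex`): `T_g F := Tr_{Γ ← Γ'} (g^* F) = Σ_{γ Γ' ∈ Γ/Γ'} (g γ⁻¹)^* F`
— on `Γ`-forms the action of the double coset `Γ g Γ = ⊔ Γ (g γ⁻¹)`. [cite: Shimura1973, §3.4 (3.4.1)] -/
def hecke (Γ : Subgroup G) (g : G) [Fintype (Γ ⧸ (heckeStab Γ g).subgroupOf Γ)] (F : Y → V) : Y → V :=
  transfer A Γ (heckeStab Γ g) (factorPullback A g F)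

/-- Unfolding. [folklore] -/
theorem hecke_def (Γ : Subgroup G) (g : G) [Fintype (Γ ⧸ (heckeStab Γ g).subgroupOf Γ)] (F : Y → V) :
    hecke A Γ g F = transfer A Γ (heckeStab Γ g) (factorPullback A g F) :=
  rfl

/-- **`T_g` as the sum over the cosets of the double coset**: `T_g F = Σ_{q = γΓ' ∈ Γ/Γ'} (g γ⁻¹)^* F` (representatives `γ = out q`;
representative-free summands in `transferTerm_mk`). [cite: Shimura1973, §3.4 (3.4.1)] -/
theorem hecke_eq_sum (hA : IsPullbackCocycle A) (Γ : Subgroup G) (g : G) [Fintype (Γ ⧸ (heckeStab Γ g).subgroupOf Γ)]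
    (F : Y → V) :
    hecke A Γ g F = ∑ q : Γ ⧸ (heckeStab Γ g).subgroupOf Γ, factorPullback A (g * (((Quotient.out q : Γ) : G))⁻¹) F := by
  unfold hecke transfer transferTerm
  exact Finset.sum_congr rfl fun q _ => (factorPullback_mul hA _ _ _).symm

/-- **`T_g` of a `Γ`-form is a `Γ`-form.** [cite: Shimura1973, §3.4] -/
theorem hecke_mem_factorForms (hA : IsPullbackCocycle A) {Γ : Subgroup G} {g : G}
    [Fintype (Γ ⧸ (heckeStab Γ g).subgroupOf Γ)] {F : Y → V} (hF : F ∈ factorForms Γ A) :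
    hecke A Γ g F ∈ factorForms Γ A :=
  transfer_mem_factorForms hA (factorPullback_mem_factorForms_heckeStab hA hF g)

/-- `T_g` is additive. [folklore] -/
theorem hecke_add {Γ : Subgroup G} {g : G} [Fintype (Γ ⧸ (heckeStab Γ g).subgroupOf Γ)] (F F' : Y → V) :
    hecke A Γ g (F + F') = hecke A Γ g F + hecke A Γ g F' := by
  rw [hecke_def, hecke_def, hecke_def, factorPullback_add, transfer_add]

/-- `T_g` is homogeneous. [folklore] -/
theorem hecke_smul {Γ : Subgroup G} {g : G} [Fintype (Γ ⧸ (heckeStab Γ g).subgroupOf Γ)] (r : R) (F : Y → V) :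
    hecke A Γ g (r • F) = r • hecke A Γ g F := by
  rw [hecke_def, hecke_def, factorPullback_smul, transfer_smul]

/-- Congruence of the transfer in the level subgroup (the `Fintype` instance is a subsingleton). [folklore] -/
theorem transfer_congr {Γ N N' : Subgroup G} [Fintype (Γ ⧸ N.subgroupOf Γ)] [Fintype (Γ ⧸ N'.subgroupOf Γ)]
    (h : N = N') (F : Y → V) : transfer A Γ N F = transfer A Γ N' F := by
  subst h
  congr 1
  exact Subsingleton.elim _ _

/-- **`T_γ F = F` for `γ ∈ Γ`** on `Γ`-forms (`Γ γ Γ = Γ`). [cite: Shimura1973, §3.1] -/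
theorem hecke_of_mem {Γ : Subgroup G} {g : G} (hg : g ∈ Γ)
    [Fintype (Γ ⧸ (heckeStab Γ g).subgroupOf Γ)] {F : Y → V} (hF : F ∈ factorForms Γ A) :
    hecke A Γ g F = F := by
  rw [hecke_def, (mem_factorForms_iff_factorPullback_eq.mp hF) g hg, transfer_of_mem hF]
  have h1 : ((heckeStab Γ g).subgroupOf Γ).index = 1 := by
    rw [heckeStab_of_mem hg, Subgroup.subgroupOf_self, Subgroup.index_top]
  rw [h1, Nat.cast_one, one_smul]

/-- **`T_{γ g} = T_g` on `Γ`-forms for `γ ∈ Γ`** (`T_g` depends on the coset `Γ g`). [cite: Shimura1973, §3.1 Prop. 3.1] -/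
theorem hecke_mul_left_of_mem (hA : IsPullbackCocycle A) {Γ : Subgroup G} {γ : G} (hγ : γ ∈ Γ) (g : G)
    [Fintype (Γ ⧸ (heckeStab Γ (γ * g)).subgroupOf Γ)] [Fintype (Γ ⧸ (heckeStab Γ g).subgroupOf Γ)]
    {F : Y → V} (hF : F ∈ factorForms Γ A) :
    hecke A Γ (γ * g) F = hecke A Γ g F := by
  rw [hecke_def, hecke_def, factorPullback_mul hA, (mem_factorForms_iff_factorPullback_eq.mp hF) γ hγ,
    transfer_congr (heckeStab_mul_left_of_mem hγ g)]

/-- **`T_{g γ} = T_g` on `Γ`-forms for `γ ∈ Γ`** — with `hecke_mul_left_of_mem`: `T_g` depends only on the double coset `Γ g Γ`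
(reindex `Γ/Γ'' ≃ Γ/Γ'`, `δΓ'' ↦ δγ⁻¹Γ'`, where `Γ'' = Γ ∩ (gγ)⁻¹Γ(gγ) = γ⁻¹Γ'γ`). [cite: Shimura1973, §3.1 Prop. 3.1] -/
theorem hecke_mul_right_of_mem (hA : IsPullbackCocycle A) {Γ : Subgroup G} (g : G) {γ : G} (hγ : γ ∈ Γ)
    [Fintype (Γ ⧸ (heckeStab Γ (g * γ)).subgroupOf Γ)] [Fintype (Γ ⧸ (heckeStab Γ g).subgroupOf Γ)]
    {F : Y → V} (hF : F ∈ factorForms Γ A) :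
    hecke A Γ (g * γ) F = hecke A Γ g F := by
  have key : ∀ a b : Γ, QuotientGroup.leftRel ((heckeStab Γ (g * γ)).subgroupOf Γ) a b ↔
      QuotientGroup.leftRel ((heckeStab Γ g).subgroupOf Γ)
        (Equiv.mulRight (⟨γ, hγ⟩⁻¹ : Γ) a) (Equiv.mulRight (⟨γ, hγ⟩⁻¹ : Γ) b) := by
    intro a b
    rw [QuotientGroup.leftRel_apply, QuotientGroup.leftRel_apply, Subgroup.mem_subgroupOf, Subgroup.mem_subgroupOf,
      Equiv.coe_mulRight]
    simp only [Subgroup.coe_mul, InvMemClass.coe_inv]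
    rw [show ((a : G) * γ⁻¹)⁻¹ * ((b : G) * γ⁻¹) = γ * (((a : G))⁻¹ * (b : G)) * γ⁻¹ by group]
    exact mem_heckeStab_mul_right_iff hγ g _
  rw [hecke_def, hecke_def]
  unfold transfer
  refine Fintype.sum_equiv (Quotient.congr (Equiv.mulRight (⟨γ, hγ⟩⁻¹ : Γ)) key) _ _ fun q => ?_
  induction q using QuotientGroup.induction_on with
  | H δ =>
    rw [show Quotient.congr _ key (δ : Γ ⧸ (heckeStab Γ (g * γ)).subgroupOf Γ) =
        ((Equiv.mulRight (⟨γ, hγ⟩⁻¹ : Γ) δ : Γ) : Γ ⧸ (heckeStab Γ g).subgroupOf Γ) from rfl,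
      transferTerm_mk hA (factorPullback_mem_factorForms_heckeStab hA hF _),
      transferTerm_mk hA (factorPullback_mem_factorForms_heckeStab hA hF _), Equiv.coe_mulRight]
    simp only [Subgroup.coe_mul, InvMemClass.coe_inv]
    rw [← factorPullback_mul hA, ← factorPullback_mul hA]
    congr 1
    group

/-- **The group function of `T_g F` is a sum of LEFT translates**: `u_{T_g F}(x) = Σ_{γΓ' ∈ Γ/Γ'} u_F(g γ⁻¹ x)`. [cite: Shimura1973, §8.3 (8.3.2)] -/
theorem toGroupFun_hecke (hA : IsPullbackCocycle A) (o : Y) {Γ : Subgroup G} {g : G}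
    [Fintype (Γ ⧸ (heckeStab Γ g).subgroupOf Γ)] (F : Y → V) (x : G) :
    toGroupFun A o (hecke A Γ g F) x =
      ∑ q : Γ ⧸ (heckeStab Γ g).subgroupOf Γ, toGroupFun A o F (g * ((((Quotient.out q : Γ) : G))⁻¹ * x)) := by
  rw [hecke_def, toGroupFun_transfer hA]
  exact Finset.sum_congr rfl fun q _ => (BallForms.toGroupFun_mul_left hA o F g _).symm

/-! ### Transitivity of the transfer through an intermediate level; the normalisation identity -/

/-- The first component of `Subgroup.quotientEquivProdOfLE` is the canonical projection. [folklore] -/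
theorem fst_quotientEquivProdOfLE {H : Type*} [Group H] {s t : Subgroup H} (h : s ≤ t) (q : H ⧸ s) :
    (Subgroup.quotientEquivProdOfLE h q).1 = Subgroup.quotientMapOfLE h q :=
  Quotient.inductionOn' q fun _ => rfl

/-- **Transitivity of the transfer**: for `N ≤ Γ' ≤ Γ` of finite index and a `Γ'`-form `F`, `Tr_{Γ←N} F = [Γ' : N] • Tr_{Γ←Γ'} F`
(each coset `γΓ'` contributes `[Γ':N]` equal terms `(γ⁻¹)^* F`). [cite: Borel1997, §5.13] -/
theorem transfer_eq_relIndex_smul_transfer (hA : IsPullbackCocycle A) {Γ Γ' N : Subgroup G} (hN : N ≤ Γ') (hΓ' : Γ' ≤ Γ)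
    [Fintype (Γ ⧸ N.subgroupOf Γ)] [Fintype (Γ ⧸ Γ'.subgroupOf Γ)] {F : Y → V} (hF : F ∈ factorForms Γ' A) :
    transfer A Γ N F = (N.relIndex Γ' : R) • transfer A Γ Γ' F := by
  classical
  have hle : N.subgroupOf Γ ≤ Γ'.subgroupOf Γ := Subgroup.comap_mono hN
  -- each term only depends on the `Γ'`-coset
  have hterm : ∀ q : Γ ⧸ N.subgroupOf Γ,
      transferTerm (A := A) Γ N F q = transferTerm (A := A) Γ Γ' F (Subgroup.quotientMapOfLE hle q) := fun q => by
    induction q using QuotientGroup.induction_on with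
    | H γ => rw [Subgroup.quotientMapOfLE_apply_mk, transferTerm_mk hA (mem_factorForms_of_le hN hF), transferTerm_mk hA hF]
  -- the fibre type of the projection is finite
  set e := Subgroup.quotientEquivProdOfLE hle with he
  haveI : Finite (↥(Γ'.subgroupOf Γ) ⧸ (N.subgroupOf Γ).subgroupOf (Γ'.subgroupOf Γ)) :=
    Finite.of_injective (fun b => e.symm (((1 : Γ) : Γ ⧸ Γ'.subgroupOf Γ), b))
      fun b₁ b₂ hb => (Prod.mk.inj (e.symm.injective hb)).2
  letI : Fintype (↥(Γ'.subgroupOf Γ) ⧸ (N.subgroupOf Γ).subgroupOf (Γ'.subgroupOf Γ)) := Fintype.ofFinite _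
  unfold transfer
  simp_rw [hterm]
  rw [← Fintype.sum_equiv e.symm (fun p => transferTerm (A := A) Γ Γ' F p.1) _ (fun p => by
      have : Subgroup.quotientMapOfLE hle (e.symm p) = (e (e.symm p)).1 := (fst_quotientEquivProdOfLE hle _).symm
      rw [this, Equiv.apply_symm_apply])]
  rw [Fintype.sum_prod_type]
  simp only [Finset.sum_const, Finset.card_univ]
  rw [← Finset.smul_sum, ← Nat.cast_smul_eq_nsmul R]
  congr 1
  rw [← Nat.card_eq_fintype_card, ← Subgroup.index_eq_card, ← Subgroup.relIndex, Subgroup.relIndex_subgroupOf hΓ']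

/-- For `N ∩ Γ` normal in `Γ` and `N ≤ Γ' = Γ ∩ g⁻¹Γg`, the section `(g γ)^* F` of a `Γ`-form `F` only depends on the coset `γ N`.
[folklore] -/
theorem factorPullback_mul_out_mk (hA : IsPullbackCocycle A) {Γ N : Subgroup G} {g : G} [(N.subgroupOf Γ).Normal]
    (hN : N ≤ heckeStab Γ g) {F : Y → V} (hF : F ∈ factorForms Γ A) (γ : Γ) :
    factorPullback A (g * ((Quotient.out (γ : Γ ⧸ N.subgroupOf Γ) : Γ) : G)) F = factorPullback A (g * (γ : G)) F := by
  -- `out (mk γ) = γ * n` with `n ∈ N`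
  have h : (γ : Γ)⁻¹ * Quotient.out (γ : Γ ⧸ N.subgroupOf Γ) ∈ N.subgroupOf Γ :=
    QuotientGroup.leftRel_apply.mp (Quotient.exact (Quotient.out_eq (γ : Γ ⧸ N.subgroupOf Γ)).symm)
  have hn : ((γ : G))⁻¹ * ((Quotient.out (γ : Γ ⧸ N.subgroupOf Γ) : Γ) : G) ∈ N := by
    simpa [Subgroup.mem_subgroupOf] using h
  set n : G := ((γ : G))⁻¹ * ((Quotient.out (γ : Γ ⧸ N.subgroupOf Γ) : Γ) : G) with hn_def
  have hout : ((Quotient.out (γ : Γ ⧸ N.subgroupOf Γ) : Γ) : G) = (γ : G) * n := by rw [hn_def]; group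
  rw [hout, ← mul_assoc, factorPullback_mul hA (g * (γ : G)) n]
  -- `(gγ)^* F` is a form for `(gγ)⁻¹ Γ (gγ) ∋ n`
  have hF' : factorPullback A (g * (γ : G)) F ∈ factorForms N A := by
    refine factorPullback_mem_factorForms hA hF fun δ hδ => ?_
    -- `γ δ γ⁻¹ ∈ N` by normality in `Γ`, hence `∈ Γ'`, hence `g (γ δ γ⁻¹) g⁻¹ ∈ Γ`
    have hδΓ : δ ∈ Γ := heckeStab_le Γ g (hN hδ)
    have hconj : (γ * ⟨δ, hδΓ⟩ * γ⁻¹ : Γ) ∈ N.subgroupOf Γ :=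
      Subgroup.Normal.conj_mem inferInstance ⟨δ, hδΓ⟩ (by simpa [Subgroup.mem_subgroupOf] using hδ) γ
    have hconj' : (γ : G) * δ * ((γ : G))⁻¹ ∈ N := by simpa [Subgroup.mem_subgroupOf] using hconj
    have := (mem_heckeStab_iff.mp (hN hconj')).2
    rw [show g * (γ : G) * δ * (g * (γ : G))⁻¹ = g * ((γ : G) * δ * ((γ : G))⁻¹) * g⁻¹ by group]
    exact this
  exact (mem_factorForms_iff_factorPullback_eq.mp hF') n hn

/-- **The normalisation identity** (section-level form of the vendored `levelProj_map_heckeCorrespondenceAction`): for a level `N ≤ Γ' = Γ ∩ g⁻¹Γg`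
with `N ∩ Γ` normal in `Γ` (e.g. the normal core `N_g` of `Γ'` in `Γ`) and of finite index, and a `Γ`-form `F`,
`Σ_{γN ∈ Γ/N} (g γ)^* F = [Γ' : N] • T_g F`.  So `T_g = [Γ' : N_g]⁻¹ · Tr_{N_g} ∘ (g ·)^*`, the topological operator's formula, read on sections.
[cite: Shimura1973, §3.4 and §8.3] -/
theorem sum_factorPullback_mul_out_eq_relIndex_smul_hecke (hA : IsPullbackCocycle A) {Γ N : Subgroup G} {g : G}
    [(N.subgroupOf Γ).Normal] (hN : N ≤ heckeStab Γ g) [Fintype (Γ ⧸ N.subgroupOf Γ)]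
    [Fintype (Γ ⧸ (heckeStab Γ g).subgroupOf Γ)] {F : Y → V} (hF : F ∈ factorForms Γ A) :
    ∑ q : Γ ⧸ N.subgroupOf Γ, factorPullback A (g * ((Quotient.out q : Γ) : G)) F =
      (N.relIndex (heckeStab Γ g) : R) • hecke A Γ g F := by
  rw [hecke_def, ← transfer_eq_relIndex_smul_transfer hA hN (heckeStab_le Γ g) (factorPullback_mem_factorForms_heckeStab hA hF g)]
  unfold transfer
  -- reindex the left sum by inversion in the finite group `Γ / (N ∩ Γ)`
  rw [← Fintype.sum_equiv (Equiv.inv (Γ ⧸ N.subgroupOf Γ)) _ _ (fun q => rfl)]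
  refine Finset.sum_congr rfl fun q _ => ?_
  induction q using QuotientGroup.induction_on with
  | H γ =>
    rw [Equiv.inv_apply, ← QuotientGroup.mk_inv, factorPullback_mul_out_mk hA hN hF,
      transferTerm_mk hA (mem_factorForms_of_le hN (factorPullback_mem_factorForms_heckeStab hA hF g)), ← factorPullback_mul hA]
    simp

/-- **The normalisation identity for a level given as a normal subgroup of `Γ`** (the shape of the vendored `heckeLevel g : Subgroup ↥Γ` = the normal
core `N_g` of `heckeStabilizer g` in `Γ`, with `heckeIndex g = N_g.relIndex (heckeStabilizer g)`): for `N₀ ⊴ Γ` of finite index with `N₀ ≤ Γ ∩ g⁻¹Γg`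
and a `Γ`-form `F`, `Σ_{γN₀ ∈ Γ/N₀} (g γ)^* F = [Γ ∩ g⁻¹Γg : N₀] • T_g F`. [cite: Shimura1973, §3.4 and §8.3] -/
theorem sum_factorPullback_mul_out_eq_relIndex_smul_hecke' (hA : IsPullbackCocycle A) {Γ : Subgroup G} {N₀ : Subgroup Γ}
    [N₀.Normal] {g : G} (hN : N₀.map Γ.subtype ≤ heckeStab Γ g) [Fintype (Γ ⧸ N₀)]
    [Fintype (Γ ⧸ (heckeStab Γ g).subgroupOf Γ)] {F : Y → V} (hF : F ∈ factorForms Γ A) :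
    ∑ q : Γ ⧸ N₀, factorPullback A (g * ((Quotient.out q : Γ) : G)) F =
      (N₀.relIndex ((heckeStab Γ g).subgroupOf Γ) : R) • hecke A Γ g F := by
  classical
  have h : (N₀.map Γ.subtype).subgroupOf Γ = N₀ := Subgroup.comap_map_eq_self_of_injective Γ.subtype_injective N₀
  haveI : ((N₀.map Γ.subtype).subgroupOf Γ).Normal := by rw [h]; infer_instance
  letI : Fintype (Γ ⧸ (N₀.map Γ.subtype).subgroupOf Γ) := Fintype.ofEquiv _ (Subgroup.quotientEquivOfEq h.symm)
  have hrel : (N₀.map Γ.subtype).relIndex (heckeStab Γ g) = N₀.relIndex ((heckeStab Γ g).subgroupOf Γ) := by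
    rw [← Subgroup.relIndex_subgroupOf (heckeStab_le Γ g), h]
  rw [← hrel, ← sum_factorPullback_mul_out_eq_relIndex_smul_hecke hA hN hF]
  refine Fintype.sum_equiv (Subgroup.quotientEquivOfEq h.symm) _ _ fun q => ?_
  induction q using QuotientGroup.induction_on with
  | H γ =>
    rw [Subgroup.quotientEquivOfEq_mk, factorPullback_mul_out_mk hA hN hF]
    -- the `N₀`-side representative: `out (mk γ) = γ n`, `n ∈ N₀ ≤ Γ'`, and `(gγn)^* F = (gγ)^* F`
    have hn : (γ : Γ)⁻¹ * Quotient.out (γ : Γ ⧸ N₀) ∈ N₀ :=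
      QuotientGroup.leftRel_apply.mp (Quotient.exact (Quotient.out_eq (γ : Γ ⧸ N₀)).symm)
    set n : G := ((γ : G))⁻¹ * ((Quotient.out (γ : Γ ⧸ N₀) : Γ) : G) with hn_def
    have hout : ((Quotient.out (γ : Γ ⧸ N₀) : Γ) : G) = (γ : G) * n := by rw [hn_def]; group
    rw [hout, ← mul_assoc, factorPullback_mul hA (g * (γ : G)) n]
    -- `n ∈ N₀ ⊴ Γ`: `(gγ)^* F` is an `N₀`-form
    have hF' : factorPullback A (g * (γ : G)) F ∈ factorForms (N₀.map Γ.subtype) A := by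
      refine factorPullback_mem_factorForms hA hF fun δ hδ => ?_
      obtain ⟨δ', hδ', rfl⟩ := hδ
      have hconj : γ * δ' * γ⁻¹ ∈ N₀ := Subgroup.Normal.conj_mem inferInstance δ' hδ' γ
      have hconj' : (γ : G) * (δ' : G) * ((γ : G))⁻¹ ∈ heckeStab Γ g := hN ⟨γ * δ' * γ⁻¹, hconj, by simp⟩
      have := (mem_heckeStab_iff.mp hconj').2
      rw [Subgroup.coe_subtype,
        show g * (γ : G) * (δ' : G) * (g * (γ : G))⁻¹ = g * ((γ : G) * (δ' : G) * ((γ : G))⁻¹) * g⁻¹ by group]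
      exact this
    have hnN : n ∈ N₀.map Γ.subtype := ⟨(γ : Γ)⁻¹ * Quotient.out (γ : Γ ⧸ N₀), hn, by simp [hn_def]⟩
    exact (mem_factorForms_iff_factorPullback_eq.mp hF') n hnN

end BallFormsHecke

/-! ### On the ball: `T_g` of a HOLOMORPHIC `Γ`-form is a holomorphic `Γ`-form -/

namespace BallFormsHecke

open Literature.Geometry.ComplexHyperbolic.BallModel (U21 Ball Jac)
open Literature.AlgebraicGeometry.ShimuraVarieties.BallForms (cotangentCocycle isPullbackCocycle_cotangentCocycle holomorphic
  holFactorForms mem_holFactorForms_iff)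

/-- **Hecke operators preserve holomorphy on the ball**: for `Γ ≤ U(2,1)` and `g` with `Γ ∩ g⁻¹Γg` of finite index in `Γ`, `T_g` of a
holomorphic `Γ`-form (weight = cotangent cocycle) is a holomorphic `Γ`-form. [cite: Shimura1973, §3.4] -/
theorem hecke_mem_holFactorForms {Γ : Subgroup U21} {g : U21} [Fintype (Γ ⧸ (heckeStab Γ g).subgroupOf Γ)]
    {F : Ball → (Fin 2 → ℂ)} (hF : F ∈ holFactorForms Γ cotangentCocycle) :
    hecke cotangentCocycle Γ g F ∈ holFactorForms Γ cotangentCocycle := by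
  rw [hecke_def]
  refine transfer_mem_holFactorForms ?_
  rw [mem_holFactorForms_iff] at hF ⊢
  exact ⟨factorPullback_mem_factorForms_heckeStab isPullbackCocycle_cotangentCocycle hF.1 g,
    factorPullback_mem_holomorphic g hF.2⟩

end BallFormsHecke

end HodgeCM

end
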